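import Summits.PneNP.PneNP.Theses.ExpanderLinearGenerators
import Summits.PneNP.PneNP.Theorems.ExpanderLinearGeneratorsMooreBound
import Summits.PneNP.PneNP.Theorems.ExpanderLinearGeneratorsLinearGeneratorDepthFregeHardDepthFloor
import Summits.PneNP.PneNP.Theorems.ExpanderLinearGeneratorsExpansionForcesDepthFregeSizeReduction
import Literature.Computability.MetaComplexity.GaussianWidth

/-!
# PneNP / ExpanderLinearGenerators — `ExpansionForcesDepthFregeSize` at locality `ℓ = 8`
(stmt-PneNP-11442, helper file)

Route `PneNP/ExpanderLinearGenerators`, support item stmt-PneNP-11442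
(`Summit.PneNP.PneNP.Theses.ExpanderLinearGenerators.ExpansionForcesDepthFregeSize`). At locality
`ℓ = 8` the item holds for a reason orthogonal to proof complexity: **an unsolvable `8`-sparse
system whose supports form an `(r, 6)`-boundary expander has at least `2^(⌊r⌋/8 - 1)` rows**, so
the refuted formula alone — the last line of any proof of its negation — has size `≥ 2^(√r)` for
`r ≥ 256`.

* `closed_vsupp_of_lincomb_eq` — the support `F` of an `𝔽₂`-dependency `Σ_{i ∈ F} row_i = (0 | 1)`
  (which an unsolvable system has, `exists_lincomb_eq_zero_one`) is a nonempty CLOSED row family: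
  every variable of a row of `F` occurs in an even number, hence in a second, row of `F`.
* `card_le_of_unsat_expander_eight` — with the Moore-type bound `card_le_of_boundaryless`
  (files `ExpanderLinearGeneratorsMoore*`): such a system has `m ≥ 2^N` rows when `8N + 8 ≤ r`.
* `length_sumEncoding_ge`, `size_ofCNF_ge`, `size_le_proofSize_of_isProofOf` — the XOR-CNF has
  `≥ m` clauses, its formula size `≥ m`, and a proof is at least as large as its last line.
* `expansionForcesDepthFregeSize_of_eq_eight` — the item's body at `ℓ = 8` (`ε = 1/2`, `R = 256`).
* `expansionForcesDepthFregeSize_iff_nine_le_seven_le` — with the `ℓ ≤ 7` and `d ≤ 6` slices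
  (`…Reduction.lean`): the item is equivalent to its restriction to `ℓ ≥ 9` and `d ≥ 7`, which
  is where its open content lives (linear-size unsolvable `(r, 3ℓ/4)`-expanders exist from `ℓ = 9`
  on, e.g. Tseitin systems of suitable `ℓ`-regular graphs on `Θ(r)` vertices).
-/

namespace Summit.PneNP.PneNP.Theorems

set_option linter.dupNamespace false -- `Summit.PneNP.PneNP.…`: summit = sub-problem (D-0017)

open Finset Literature.Computability.MetaComplexity Literature.Computability.Complexity

/-! ### The support of a dependency is a closed row family -/

/-- **The support of an `𝔽₂`-dependency is closed.** If `Σ_i v_i · row_i` has zero coefficient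
vector, then every variable in the support of a row `a` with `v_a ≠ 0` lies in the support of a
second row `a' ≠ a` with `v_{a'} ≠ 0` (the number of such rows is even). [folklore] -/
theorem closed_vsupp_of_lincomb_eq {m n : ℕ} (E : Fin m → LinEqMod 2 n) {v : Fin m → ZMod 2}
    (hv : (lincomb v E).1 = 0) {a : Fin m} (ha : a ∈ vsupp v) {j : Fin n} (hj : j ∈ (E a).supp) :
    ∃ a' ∈ vsupp v, a' ≠ a ∧ j ∈ (E a').supp := by
  classical
  set T : Finset (Fin m) := univ.filter fun i => v i * (E i).1 j ≠ 0 with hT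
  have hsum : ∑ i, v i * (E i).1 j = 0 := by
    have := congrFun hv j
    simpa [lincomb] using this
  -- the sum is the number of non-zero terms, mod 2
  have hsumT : ∑ i, v i * (E i).1 j = (T.card : ZMod 2) := by
    rw [← Finset.sum_filter_ne_zero, ← hT]
    rw [Finset.card_eq_sum_ones, Nat.cast_sum]
    refine Finset.sum_congr rfl fun i hi => ?_
    have hne : v i * (E i).1 j ≠ 0 := (Finset.mem_filter.1 hi).2
    rw [Nat.cast_one]
    exact zmod_two_eq_one_of_ne_zero hne
  have heven : Even T.card := by
    rw [← ZMod.natCast_eq_zero_iff_even, ← hsumT, hsum]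
  have haT : a ∈ T := by
    refine Finset.mem_filter.2 ⟨Finset.mem_univ _, mul_ne_zero ?_ ?_⟩
    · simpa [vsupp] using ha
    · simpa [LinEqMod.supp] using hj
  have hcard : 1 < T.card := by
    have h1 : 1 ≤ T.card := Finset.card_pos.2 ⟨a, haT⟩
    rcases heven with ⟨k, hk⟩
    omega
  obtain ⟨a', ha'T, hne⟩ := Finset.exists_mem_ne hcard a
  have hprod : v a' * (E a').1 j ≠ 0 := (Finset.mem_filter.1 ha'T).2
  refine ⟨a', ?_, hne, ?_⟩
  · simpa [vsupp] using left_ne_zero_of_mul hprod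
  · simpa [LinEqMod.supp] using right_ne_zero_of_mul hprod

/-- **Unsolvable expanding `8`-sparse systems are exponentially large.** If an `8`-sparse system
over `𝔽₂` whose supports form an `(r, 6)`-boundary expander (`r ≥ 1`) is unsolvable, it has at
least `2^N` rows whenever `8N + 8 ≤ r`: the support of a dependency `Σ row_i = (0 | 1)` is a
nonempty closed family of rows with `6 ≤ |supp| ≤ 8`, to which the Moore-type bound
`MooreBound.card_le_of_boundaryless` applies. [folklore] -/
theorem card_le_of_unsat_expander_eight {m n : ℕ} (E : Fin m → LinEqMod 2 n)
    (hsparse : ∀ i, (E i).supp.card ≤ 8) {r : ℝ} (hr : 1 ≤ r)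
    (hexp : IsBoundaryExpander (fun i => (E i).supp.map Fin.valEmbedding) r 6)
    (hunsat : ¬ SystemSat E Finset.univ) (N : ℕ) (hN : ((8 * N + 8 : ℕ) : ℝ) ≤ r) :
    2 ^ N ≤ m := by
  classical
  obtain ⟨v, hv⟩ := exists_lincomb_eq_zero_one E hunsat
  have hv1 : (lincomb v E).1 = 0 := by rw [hv]
  have hv2 : ∑ i, v i * (E i).2 = 1 := by
    have := congrArg Prod.snd hv
    simpa [lincomb] using this
  set F : Finset (Fin m) := vsupp v with hF
  set S : Fin m → Finset ℕ := fun i => (E i).supp.map Fin.valEmbedding with hS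
  -- `F` is nonempty
  have hFne : F.Nonempty := by
    rw [Finset.nonempty_iff_ne_empty]
    intro hF0
    have hv0 : ∀ i, v i = 0 := fun i => by
      by_contra h
      have : i ∈ F := by simpa [hF, vsupp] using h
      rw [hF0] at this
      simp at this
    simp [hv0] at hv2
  -- `F` is closed
  have hcl : ∀ a ∈ F, ∀ x ∈ S a, ∃ a' ∈ F, a' ≠ a ∧ x ∈ S a' := by
    intro a ha x hx
    obtain ⟨j, hj, rfl⟩ := Finset.mem_map.1 hx
    obtain ⟨a', ha', hne, hj'⟩ := closed_vsupp_of_lincomb_eq E hv1 ha hj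
    exact ⟨a', ha', hne, Finset.mem_map.2 ⟨j, hj', rfl⟩⟩
  -- degrees
  have h6 : ∀ a, 6 ≤ (S a).card := by
    intro a
    have h := hexp {a} (by simpa using hr)
    have hb : (boundary S {a}).card ≤ (S a).card :=
      (Finset.card_le_card (boundary_subset_cover _)).trans (by simp [cover])
    have h' : (6 : ℝ) ≤ (S a).card := by
      have : (6 : ℝ) * (({a} : Finset (Fin m)).card : ℝ) = 6 := by simp
      rw [this] at h
      exact h.trans (by exact_mod_cast hb)
    exact_mod_cast h'
  have h4 : ∀ a ∈ F, 4 ≤ (S a).card := fun a _ => le_trans (by norm_num) (h6 a)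
  have hS8 : ∀ a ∈ F, (S a).card ≤ 8 := fun a _ => by
    rw [hS, Finset.card_map]; exact hsparse a
  calc 2 ^ N ≤ F.card := MooreBound.card_le_of_boundaryless hFne hcl h4 hS8 hexp N hN
    _ ≤ Fintype.card (Fin m) := Finset.card_le_univ F
    _ = m := Fintype.card_fin m

/-! ### The refuted formula is at least as large as the number of rows -/

/-- The XOR-CNF of a system all of whose rows have support `≥ 2` has at least one clause per row.
[folklore] -/
theorem length_sumEncoding_ge {m n : ℕ} (E : Fin m → LinEqMod 2 n) (h2 : ∀ i, 2 ≤ (E i).supp.card) :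
    m ≤ (sumEncoding 1 E).length := by
  have hlen : (sumEncoding 1 E).length =
      ((List.finRange m).map fun k => (equationCNF 1 (E k)).length).sum := by
    simp [sumEncoding, List.length_flatMap]
  rw [hlen]
  have hm : ((List.finRange m).map fun k => (equationCNF 1 (E k)).length).length = m := by simp
  conv_lhs => rw [← hm]
  refine List.length_le_sum_of_one_le _ fun x hx => ?_
  obtain ⟨k, -, rfl⟩ := List.mem_map.1 hx
  obtain ⟨D, hD, -⟩ := exists_neg_clause_of_two_le_card (h2 k)
  exact List.length_pos_of_mem hD

/-- The formula of a CNF is at least as large as its number of clauses. [folklore] -/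
theorem size_ofCNF_ge (ψ : CNF ℕ) : ψ.length ≤ (PropForm.ofCNF ψ).size := by
  induction ψ with
  | nil => simp [PropForm.ofCNF, PropForm.size]
  | cons C ψ ih =>
    rw [ofCNF_cons]
    simp only [PropForm.size, List.length_cons]
    omega

/-- A proof is at least as large as its last line. [folklore] -/
theorem size_le_proofSize_of_isProofOf {F : FregeSystem} {π : List (PropForm ℕ)}
    {θ : PropForm ℕ} (h : F.IsProofOf π θ) : θ.size ≤ proofSize π := by
  have hlast : π.getLast? = some θ := h.2
  have hne : π ≠ [] := by rintro rfl; simp at hlast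
  have hmem : θ ∈ π := by
    rw [List.getLast?_eq_some_getLast hne] at hlast
    obtain rfl := Option.some.inj hlast
    exact List.getLast_mem hne
  exact List.le_sum_of_mem (List.mem_map_of_mem hmem)

/-! ### The `ℓ = 8` slice -/

/-- **The expansion-scale law at locality `ℓ = 8`** (item stmt-PneNP-11442,
`ExpansionForcesDepthFregeSize`, with its leading `∀ ℓ` specialised to `ℓ = 8`): with `ε = 1/2`
and `R = 256`, every depth-`d` `textbookFrege` proof `π` of `¬ ofCNF (sumEncoding 1 E)` for an
`8`-sparse `(r, 6)`-boundary-expanding unsolvable `E` has `proofSize π ≥ 2^(√r)` — indeed `π`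
ends with the refuted formula, which has `≥ m ≥ 2^(⌊r⌋/8 - 1) ≥ 2^(√r)` symbols
(`card_le_of_unsat_expander_eight`). The depth plays no role. [folklore] -/
theorem expansionForcesDepthFregeSize_of_eq_eight (ℓ d : ℕ) (hℓ : ℓ = 8) :
    ∃ ε : ℝ, 0 < ε ∧ ∃ R : ℝ, ∀ r : ℝ, R ≤ r → ∀ (n m : ℕ) (E : Fin m → LinEqMod 2 n),
      (∀ i, (E i).supp.card ≤ ℓ) →
      IsBoundaryExpander (fun i => (E i).supp.map Fin.valEmbedding) r (3 / 4 * ℓ) →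
      ¬ SystemSat E Finset.univ →
      ∀ π : List (PropForm ℕ), textbookFrege.IsDepthProofOf d π
        (PropForm.neg (PropForm.ofCNF (sumEncoding 1 E))) →
      (2 : ℝ) ^ (r ^ ε) ≤ (proofSize π : ℝ) := by
  subst hℓ
  refine ⟨1 / 2, by norm_num, 256, fun r hr n m E hsparse hexp hunsat π hπ => ?_⟩
  have hr1 : (1 : ℝ) ≤ r := by linarith
  have hr0 : (0 : ℝ) ≤ r := by linarith
  -- the expansion constant `3/4 · 8 = 6`
  have hexp6 : IsBoundaryExpander (fun i => (E i).supp.map Fin.valEmbedding) r 6 := by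
    intro I hI
    have := hexp I hI
    norm_num at this
    exact this
  -- `N = ⌊r⌋/8 - 1`, `8N + 8 ≤ r`, `√r ≤ N`
  set N : ℕ := ⌊r⌋₊ / 8 - 1 with hNdef
  have hfloor : 256 ≤ ⌊r⌋₊ := Nat.le_floor (by exact_mod_cast hr)
  have hN : ((8 * N + 8 : ℕ) : ℝ) ≤ r := by
    have h1 : 8 * N + 8 ≤ ⌊r⌋₊ := by omega
    exact le_trans (by exact_mod_cast h1) (Nat.floor_le hr0)
  have hsqrtN : r ^ (1 / 2 : ℝ) ≤ (N : ℝ) := by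
    rw [← Real.sqrt_eq_rpow]
    have h1 : ⌊r⌋₊ ≤ 8 * N + 15 := by omega
    have h2 : r < (⌊r⌋₊ : ℝ) + 1 := Nat.lt_floor_add_one r
    have h3 : (⌊r⌋₊ : ℝ) ≤ 8 * N + 15 := by exact_mod_cast h1
    have hs16 : (16 : ℝ) ≤ Real.sqrt r := by
      rw [show (16 : ℝ) = Real.sqrt 256 by rw [show (256 : ℝ) = 16 ^ 2 by norm_num,
        Real.sqrt_sq (by norm_num)]]
      exact Real.sqrt_le_sqrt hr
    nlinarith [Real.sq_sqrt hr0, Real.sqrt_nonneg r]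
  -- the row count and the size of the last line
  have hm : 2 ^ N ≤ m := card_le_of_unsat_expander_eight E hsparse hr1 hexp6 hunsat N hN
  have h2 : ∀ i, 2 ≤ (E i).supp.card := fun i => by
    have h6 := le_card_supp_of_expander E hr1 hexp i
    norm_num at h6
    omega
  have hsize : m ≤ proofSize π :=
    calc m ≤ (sumEncoding 1 E).length := length_sumEncoding_ge E h2
      _ ≤ (PropForm.ofCNF (sumEncoding 1 E)).size := size_ofCNF_ge _
      _ ≤ (PropForm.neg (PropForm.ofCNF (sumEncoding 1 E))).size := by
          simp [PropForm.size]
      _ ≤ proofSize π := size_le_proofSize_of_isProofOf hπ.1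
  -- assemble
  calc (2 : ℝ) ^ (r ^ (1 / 2 : ℝ)) ≤ (2 : ℝ) ^ (N : ℝ) :=
        Real.rpow_le_rpow_of_exponent_le (by norm_num) hsqrtN
    _ = ((2 ^ N : ℕ) : ℝ) := by rw [Real.rpow_natCast]; push_cast; ring
    _ ≤ (m : ℝ) := by exact_mod_cast hm
    _ ≤ (proofSize π : ℝ) := by exact_mod_cast hsize

open Summit.PneNP.PneNP.Theses.ExpanderLinearGenerators in
/-- **Reduction of `ExpansionForcesDepthFregeSize` to localities `ℓ ≥ 9` and depths `d ≥ 7`.**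
Item stmt-PneNP-11442 is equivalent to its restriction to `9 ≤ ℓ` and `7 ≤ d`: the localities
`ℓ ≤ 7` hold vacuously (no unsolvable expander, `expansionForcesDepthFregeSize_of_le_seven`),
`ℓ = 8` holds by counting (`expansionForcesDepthFregeSize_of_eq_eight`), and the depths `d ≤ 6`
hold vacuously (no proof of that depth, `expansionForcesDepthFregeSize_of_depth_le_six`).
[folklore] -/
theorem expansionForcesDepthFregeSize_iff_nine_le_seven_le :
    ExpansionForcesDepthFregeSize ↔
    ∀ (ℓ d : ℕ), 9 ≤ ℓ → 7 ≤ d → ∃ ε : ℝ, 0 < ε ∧ ∃ R : ℝ, ∀ r : ℝ, R ≤ r →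
      ∀ (n m : ℕ) (E : Fin m → LinEqMod 2 n),
      (∀ i, (E i).supp.card ≤ ℓ) →
      IsBoundaryExpander (fun i => (E i).supp.map Fin.valEmbedding) r (3 / 4 * ℓ) →
      ¬ SystemSat E Finset.univ →
      ∀ π : List (PropForm ℕ), textbookFrege.IsDepthProofOf d π
        (PropForm.neg (PropForm.ofCNF (sumEncoding 1 E))) →
      (2 : ℝ) ^ (r ^ ε) ≤ (proofSize π : ℝ) := by
  rw [expansionForcesDepthFregeSize_iff_eight_le_seven_le]
  refine ⟨fun h ℓ d hℓ hd => h ℓ d (by omega) hd, fun h ℓ d hℓ hd => ?_⟩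
  by_cases h8 : ℓ = 8
  · exact expansionForcesDepthFregeSize_of_eq_eight ℓ d h8
  · exact h ℓ d (by omega) hd

end Summit.PneNP.PneNP.Theorems
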